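/-
Copyright: the b2b-balaban T⁴-continuum CRUX team, row NE7b leaf lineage `t4-ne7b-formalise-leaf-03` (gen 140). Project licence.
-/
import Summits.QuantumFields.BalabanUV.T4Continuum.Spine.NE7b.ConvexWindowMass

/-!
# THE BALL-MASS LETTER WITH A LOCAL UPPER PINCH: `Λ`-smoothness is needed ON THE WINDOW ONLY, at the price `η ↦ η∕(1 − η_Λ)`,
# `η_Λ = 2^{d∕2}e^{−ΛR²∕4}` (row NE7b, node U5c; companion of the OWNER's `…ConvexWindowMass`; kernel lemmas of real analysis)

Cell `pub-balaban`, sub-cell `t4`, spine estimate NE7b (`T4WeightBudget.RelWeightBound`; the cell's OWN estimate — NOT PRINTED in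
[Bałaban 1983–89], NOT PROVED).  Crux-route work under `Spine/NE7b/` by a row leaf on the convexity road; NOTHING of Bałaban's is named
or asserted; no `T4Continuum/Support` leaf typed; no `def`; zero `sorry`.

WHY.  The OWNER's `…ConvexWindowMass.ballMass_ge_of_pinch` (the `hmass` letter of the convexity road for a Euclidean ball, two-sided
pinch model) displays the upper pinch `hup : V y ≤ V x₀ + (Λ∕2)‖y − x₀‖²` for ALL `y` — in print's currency one more Δ4-class letter
(a `Λ`-smooth ∕ `C^{1,1}` extension of the exponent OFF the window; PRICING-NE7b v77 F417, π-ne7bref-g70-1's upper half).  The pricing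
desk located the cheaper form (σ-ne7bref-g70-1): «a LOCAL upper pinch on `B(x₀, R)` only gives
`∫e^{−V} ≥ ∫_B e^{−V} ≥ e^{−V x₀}(2π∕Λ)^{d∕2}(1 − 2^{d∕2}e^{−ΛR²∕4})` by the file's OWN tail lemma applied to the Λ-Gaussian, hence the
same END with `η ↦ η∕(1 − η_Λ)`, ~20–25 Lean lines, free by value (η_Λ ≤ η)».  THIS FILE types exactly that, BY NAME over the OWNER's
two Gaussian lemmas (`tailIntegral_exp_neg_le_of_lowerPinch` run on the `Λ`-Gaussian itself, whose lower pinch is an equality).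

WHAT IS PROVED ([folklore]; `GaussianFourier.integral_rexp_neg_mul_sq_norm`, translation invariance, the OWNER's (10) BY NAME):
§1 **`gaussian_ballIntegral_ge`** — `(π∕(Λ∕2))^{d∕2} − e^{−ΛR²∕4}(π∕(Λ∕4))^{d∕2} ≤ ∫_{‖y−x₀‖<R} e^{−(Λ∕2)‖y−x₀‖²}`
(`(π∕(Λ∕4))^{d∕2} = 2^{d∕2}(π∕(Λ∕2))^{d∕2}`: the located `η_Λ`).
§2 **`ballIntegral_exp_neg_ge_of_localUpperPinch`** — the LOCAL upper pinch `‖y − x₀‖ < R → V y ≤ V x₀ + (Λ∕2)‖y − x₀‖²` and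
`e^{−V}` integrable give `e^{−V x₀}·((π∕(Λ∕2))^{d∕2} − e^{−ΛR²∕4}(π∕(Λ∕4))^{d∕2}) ≤ ∫_{‖y−x₀‖<R} e^{−V}` (hence `≤ ∫e^{−V}`:
`integral_exp_neg_ge_of_localUpperPinch`).
§3 **`ballMass_ge_of_localPinch`** — the OWNER's END with `hup` LOCALISED: lower pinch global (`λ`), upper pinch on the ball (`Λ`),
displayed positivity `hΛR : e^{−ΛR²∕4}(π∕(Λ∕4))^{d∕2} < (π∕(Λ∕2))^{d∕2}` of the localised denominator ⊢
`(1 − η_loc)·∫e^{−V} ≤ ∫_{‖y−x₀‖<R} e^{−V}`, `η_loc = e^{−λR²∕4}(π∕(λ∕4))^{d∕2} ∕ ((π∕(Λ∕2))^{d∕2} − e^{−ΛR²∕4}(π∕(Λ∕4))^{d∕2})`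
(= the OWNER's `η ∕ (1 − η_Λ)`); and `ballMass_ge_of_firstOrder_localPinch` — the same with `hlow` SUPPLIED from the road's first-order
letter at a critical point (`lowerPinch_of_firstOrder` BY NAME), so that the only letter beyond the road's own is the LOCAL upper pinch.

NOT HERE (honest): `λ`, `Λ`, `R` of Bałaban's exponents and windows ((A1c) readings); the existence of the critical point (the companion
`…ConvexMinimiser`, separately staged); anything of Bałaban's.  NE7b NOT PRINTED ∕ NOT PROVED; spine PROVED 0∕9; rung (B)+1 on a FINITE
torus — NOT infinite volume, NOT the mass gap, NOT Clay.
HONEST DEPENDENCY: continuum YM on T⁴ ⇐ BetaPertH ∧ nine spine estimates (0/9 proved); BetaPertH ⇐ (D1) ∧ (D4) ∧ CAP+tail; G-an2-4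
gates asym, D1 and NE2/3/4.
-/

set_option autoImplicit false

noncomputable section

open MeasureTheory Real
open scoped RealInnerProductSpace

namespace Summit.QuantumFields.BalabanUV.T4Continuum.NE7b.ConvexWindowMassLocal

variable {n : ℕ}

/-! ## §1 The `Λ`-Gaussian's own ball mass -/

/-- **THE `Λ`-GAUSSIAN CARRIES ALL BUT `η_Λ` OF ITS MASS ON THE BALL**: for `Λ > 0`, `R ≥ 0` and any centre `x₀`,
`(π∕(Λ∕2))^{d∕2} − e^{−ΛR²∕4}·(π∕(Λ∕4))^{d∕2} ≤ ∫_{‖y−x₀‖<R} e^{−(Λ∕2)‖y−x₀‖²}` — the OWNER's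
`tailIntegral_exp_neg_le_of_lowerPinch` applied to the exponent `(Λ∕2)‖y − x₀‖²` itself (its lower pinch holds with equality). [folklore] -/
theorem gaussian_ballIntegral_ge {Lam R : ℝ} (hLam : 0 < Lam) (hR : 0 ≤ R) (x₀ : EuclideanSpace ℝ (Fin n)) :
    (π / (Lam / 2)) ^ (Module.finrank ℝ (EuclideanSpace ℝ (Fin n)) / 2 : ℝ) -
        exp (-(Lam * R ^ 2 / 4)) * (π / (Lam / 4)) ^ (Module.finrank ℝ (EuclideanSpace ℝ (Fin n)) / 2 : ℝ) ≤
      ∫ y in {y | ‖y - x₀‖ < R}, exp (-(Lam / 2 * ‖y - x₀‖ ^ 2)) := by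
  set d2 : ℝ := (Module.finrank ℝ (EuclideanSpace ℝ (Fin n)) / 2 : ℝ) with hd2
  set W : EuclideanSpace ℝ (Fin n) → ℝ := fun y => Lam / 2 * ‖y - x₀‖ ^ 2 with hW
  have hb : 0 < Lam / 2 := by positivity
  -- the Gaussian is integrable (translation of the centred one) and has total mass `(π∕(Λ∕2))^{d∕2}`
  have hGi : Integrable fun y : EuclideanSpace ℝ (Fin n) => exp (-W y) := by
    have h := (Literature.Analysis.FunctionSpaces.integrable_rexp_neg_mul_sq_norm
      (V := EuclideanSpace ℝ (Fin n)) hb).comp_sub_right x₀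
    refine h.congr (ae_of_all _ fun y => ?_)
    simp only [hW, neg_mul]
  have htot : ∫ y, exp (-W y) = (π / (Lam / 2)) ^ d2 := by
    have e : (fun y => exp (-W y)) =
        fun y => (fun v : EuclideanSpace ℝ (Fin n) => exp (-(Lam / 2) * ‖v‖ ^ 2)) (y - x₀) := by
      funext y; simp only [hW, neg_mul]
    rw [e, integral_sub_right_eq_self (μ := volume) (fun v : EuclideanSpace ℝ (Fin n) => exp (-(Lam / 2) * ‖v‖ ^ 2)) x₀,
      GaussianFourier.integral_rexp_neg_mul_sq_norm hb]
  -- its tail off the ball, by the OWNER's lemma at the exponent `W` (lower pinch with equality, `W x₀ = 0`)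
  have hW0 : W x₀ = 0 := by simp [hW]
  have hlowW : ∀ y, W x₀ + Lam / 2 * ‖y - x₀‖ ^ 2 ≤ W y := fun y => by rw [hW0, zero_add]
  have htail := ConvexWindowMass.tailIntegral_exp_neg_le_of_lowerPinch hLam hR x₀ hlowW hGi
  rw [hW0, neg_zero, exp_zero, one_mul] at htail
  -- split the total mass
  have hS : MeasurableSet {y : EuclideanSpace ℝ (Fin n) | ‖y - x₀‖ < R} :=
    measurableSet_lt (continuous_id.sub continuous_const).norm.measurable measurable_const
  have hcompl : {y : EuclideanSpace ℝ (Fin n) | ‖y - x₀‖ < R}ᶜ = {y | R ≤ ‖y - x₀‖} := by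
    ext y; simp [not_lt]
  have hsplit := integral_add_compl hS hGi
  rw [hcompl, htot] at hsplit
  linarith

/-! ## §2 The lower bound of the mass from a LOCAL upper pinch -/

/-- **BALL MASS FROM A LOCAL UPPER PINCH**: `V y ≤ V x₀ + (Λ∕2)‖y−x₀‖²` for `‖y − x₀‖ < R` only (`Λ > 0`, `R ≥ 0`), `e^{−V}` integrable
⊢ `e^{−V x₀}·((π∕(Λ∕2))^{d∕2} − e^{−ΛR²∕4}(π∕(Λ∕4))^{d∕2}) ≤ ∫_{‖y−x₀‖<R} e^{−V}`. [folklore] -/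
theorem ballIntegral_exp_neg_ge_of_localUpperPinch {V : EuclideanSpace ℝ (Fin n) → ℝ} {Lam R : ℝ} (hLam : 0 < Lam) (hR : 0 ≤ R)
    (x₀ : EuclideanSpace ℝ (Fin n)) (hup : ∀ y, ‖y - x₀‖ < R → V y ≤ V x₀ + Lam / 2 * ‖y - x₀‖ ^ 2)
    (hZ : Integrable fun y => exp (-V y)) :
    exp (-V x₀) * ((π / (Lam / 2)) ^ (Module.finrank ℝ (EuclideanSpace ℝ (Fin n)) / 2 : ℝ) -
        exp (-(Lam * R ^ 2 / 4)) * (π / (Lam / 4)) ^ (Module.finrank ℝ (EuclideanSpace ℝ (Fin n)) / 2 : ℝ)) ≤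
      ∫ y in {y | ‖y - x₀‖ < R}, exp (-V y) := by
  have hS : MeasurableSet {y : EuclideanSpace ℝ (Fin n) | ‖y - x₀‖ < R} :=
    measurableSet_lt (continuous_id.sub continuous_const).norm.measurable measurable_const
  have hb : 0 < Lam / 2 := by positivity
  have hGi : Integrable fun y : EuclideanSpace ℝ (Fin n) => exp (-V x₀) * exp (-(Lam / 2 * ‖y - x₀‖ ^ 2)) := by
    have h := ((Literature.Analysis.FunctionSpaces.integrable_rexp_neg_mul_sq_norm
      (V := EuclideanSpace ℝ (Fin n)) hb).comp_sub_right x₀).const_mul (exp (-V x₀))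
    refine h.congr (ae_of_all _ fun y => ?_)
    simp only [neg_mul]
  calc exp (-V x₀) * ((π / (Lam / 2)) ^ (Module.finrank ℝ (EuclideanSpace ℝ (Fin n)) / 2 : ℝ) -
        exp (-(Lam * R ^ 2 / 4)) * (π / (Lam / 4)) ^ (Module.finrank ℝ (EuclideanSpace ℝ (Fin n)) / 2 : ℝ))
      ≤ exp (-V x₀) * ∫ y in {y | ‖y - x₀‖ < R}, exp (-(Lam / 2 * ‖y - x₀‖ ^ 2)) :=
        mul_le_mul_of_nonneg_left (gaussian_ballIntegral_ge hLam hR x₀) (exp_pos _).le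
    _ = ∫ y in {y | ‖y - x₀‖ < R}, exp (-V x₀) * exp (-(Lam / 2 * ‖y - x₀‖ ^ 2)) := (integral_const_mul _ _).symm
    _ ≤ ∫ y in {y | ‖y - x₀‖ < R}, exp (-V y) := by
        refine setIntegral_mono_on hGi.integrableOn hZ.integrableOn hS fun y hy => ?_
        rw [← exp_add]
        exact exp_le_exp.2 (by linarith [hup y hy])

/-- The same bound for the whole mass: `e^{−V x₀}·((π∕(Λ∕2))^{d∕2} − e^{−ΛR²∕4}(π∕(Λ∕4))^{d∕2}) ≤ ∫e^{−V}` under the LOCAL upper pinch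
(compare the OWNER's `integral_exp_neg_ge_of_upperPinch`, which asks the pinch everywhere and has no `η_Λ` loss). [folklore] -/
theorem integral_exp_neg_ge_of_localUpperPinch {V : EuclideanSpace ℝ (Fin n) → ℝ} {Lam R : ℝ} (hLam : 0 < Lam) (hR : 0 ≤ R)
    (x₀ : EuclideanSpace ℝ (Fin n)) (hup : ∀ y, ‖y - x₀‖ < R → V y ≤ V x₀ + Lam / 2 * ‖y - x₀‖ ^ 2)
    (hZ : Integrable fun y => exp (-V y)) :
    exp (-V x₀) * ((π / (Lam / 2)) ^ (Module.finrank ℝ (EuclideanSpace ℝ (Fin n)) / 2 : ℝ) -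
        exp (-(Lam * R ^ 2 / 4)) * (π / (Lam / 4)) ^ (Module.finrank ℝ (EuclideanSpace ℝ (Fin n)) / 2 : ℝ)) ≤
      ∫ y, exp (-V y) :=
  (ballIntegral_exp_neg_ge_of_localUpperPinch hLam hR x₀ hup hZ).trans
    (setIntegral_le_integral hZ (ae_of_all _ fun _ => (exp_pos _).le))

/-! ## §3 The OWNER's END with the upper pinch localised -/

/-- **THE BALL CARRIES ALL BUT THE FRACTION `η_loc = η∕(1 − η_Λ)`** (the OWNER's `ballMass_ge_of_pinch` with `hup` LOCALISED to the ball):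
lower pinch `V x₀ + (λ∕2)‖y−x₀‖² ≤ V y` everywhere, upper pinch `V y ≤ V x₀ + (Λ∕2)‖y−x₀‖²` on `‖y − x₀‖ < R` only, and the displayed
positivity `e^{−ΛR²∕4}(π∕(Λ∕4))^{d∕2} < (π∕(Λ∕2))^{d∕2}` of the localised Gaussian mass ⊢
`(1 − e^{−λR²∕4}(π∕(λ∕4))^{d∕2} ∕ ((π∕(Λ∕2))^{d∕2} − e^{−ΛR²∕4}(π∕(Λ∕4))^{d∕2}))·∫e^{−V} ≤ ∫_{‖y−x₀‖<R} e^{−V}`. [folklore] -/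
theorem ballMass_ge_of_localPinch {V : EuclideanSpace ℝ (Fin n) → ℝ} {lam Lam R : ℝ} (hlam : 0 < lam) (hLam : 0 < Lam) (hR : 0 ≤ R)
    (x₀ : EuclideanSpace ℝ (Fin n)) (hlow : ∀ y, V x₀ + lam / 2 * ‖y - x₀‖ ^ 2 ≤ V y)
    (hup : ∀ y, ‖y - x₀‖ < R → V y ≤ V x₀ + Lam / 2 * ‖y - x₀‖ ^ 2) (hZ : Integrable fun y => exp (-V y))
    (hΛR : exp (-(Lam * R ^ 2 / 4)) * (π / (Lam / 4)) ^ (Module.finrank ℝ (EuclideanSpace ℝ (Fin n)) / 2 : ℝ) <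
      (π / (Lam / 2)) ^ (Module.finrank ℝ (EuclideanSpace ℝ (Fin n)) / 2 : ℝ)) :
    (1 - exp (-(lam * R ^ 2 / 4)) * (π / (lam / 4)) ^ (Module.finrank ℝ (EuclideanSpace ℝ (Fin n)) / 2 : ℝ) /
        ((π / (Lam / 2)) ^ (Module.finrank ℝ (EuclideanSpace ℝ (Fin n)) / 2 : ℝ) -
          exp (-(Lam * R ^ 2 / 4)) * (π / (Lam / 4)) ^ (Module.finrank ℝ (EuclideanSpace ℝ (Fin n)) / 2 : ℝ))) * ∫ y, exp (-V y) ≤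
      ∫ y in {y | ‖y - x₀‖ < R}, exp (-V y) := by
  set d2 : ℝ := (Module.finrank ℝ (EuclideanSpace ℝ (Fin n)) / 2 : ℝ) with hd2
  set D : ℝ := (π / (Lam / 2)) ^ d2 - exp (-(Lam * R ^ 2 / 4)) * (π / (Lam / 4)) ^ d2 with hD
  have hDpos : 0 < D := by rw [hD]; linarith
  have hS : MeasurableSet {y : EuclideanSpace ℝ (Fin n) | ‖y - x₀‖ < R} :=
    measurableSet_lt (continuous_id.sub continuous_const).norm.measurable measurable_const
  have hcompl : {y : EuclideanSpace ℝ (Fin n) | ‖y - x₀‖ < R}ᶜ = {y | R ≤ ‖y - x₀‖} := by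
    ext y; simp [not_lt]
  have hsplit := integral_add_compl hS hZ
  rw [hcompl] at hsplit
  -- the two Gaussian bounds: the local one of §2 and the OWNER's tail
  have hlowZ : exp (-V x₀) * D ≤ ∫ y, exp (-V y) := integral_exp_neg_ge_of_localUpperPinch hLam hR x₀ hup hZ
  have htail := ConvexWindowMass.tailIntegral_exp_neg_le_of_lowerPinch hlam hR x₀ hlow hZ
  -- tail ≤ η_loc·∫e^{−V}
  have htail' : ∫ y in {y | R ≤ ‖y - x₀‖}, exp (-V y) ≤
      (exp (-(lam * R ^ 2 / 4)) * (π / (lam / 4)) ^ d2 / D) * ∫ y, exp (-V y) := by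
    calc ∫ y in {y | R ≤ ‖y - x₀‖}, exp (-V y)
        ≤ exp (-V x₀) * exp (-(lam * R ^ 2 / 4)) * (π / (lam / 4)) ^ d2 := htail
      _ = (exp (-(lam * R ^ 2 / 4)) * (π / (lam / 4)) ^ d2 / D) * (exp (-V x₀) * D) := by
          field_simp
      _ ≤ (exp (-(lam * R ^ 2 / 4)) * (π / (lam / 4)) ^ d2 / D) * ∫ y, exp (-V y) :=
          mul_le_mul_of_nonneg_left hlowZ (by positivity)
  have hball : ∫ y in {y | ‖y - x₀‖ < R}, exp (-V y) =
      (∫ y, exp (-V y)) - ∫ y in {y | R ≤ ‖y - x₀‖}, exp (-V y) := by linarith [hsplit]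
  rw [hball]
  linarith [htail']

/-- **THE SAME AT A CRITICAL POINT OF THE ROAD's EXPONENT**: with the road's first-order `λ`-convexity letter for all `x, y` and
`∇V x₀ = 0`, the lower pinch is the OWNER's `lowerPinch_of_firstOrder` BY NAME, so the only letter beyond the road's own is the LOCAL
upper pinch on the ball (and the displayed positivity `hΛR`). [folklore] -/
theorem ballMass_ge_of_firstOrder_localPinch {V : EuclideanSpace ℝ (Fin n) → ℝ} {lam Lam R : ℝ} (hlam : 0 < lam) (hLam : 0 < Lam)
    (hR : 0 ≤ R)
    (hV : ∀ x y : EuclideanSpace ℝ (Fin n), V x + ⟪gradient V x, y - x⟫ + lam / 2 * ‖y - x‖ ^ 2 ≤ V y)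
    {x₀ : EuclideanSpace ℝ (Fin n)} (hcrit : gradient V x₀ = 0)
    (hup : ∀ y, ‖y - x₀‖ < R → V y ≤ V x₀ + Lam / 2 * ‖y - x₀‖ ^ 2) (hZ : Integrable fun y => exp (-V y))
    (hΛR : exp (-(Lam * R ^ 2 / 4)) * (π / (Lam / 4)) ^ (Module.finrank ℝ (EuclideanSpace ℝ (Fin n)) / 2 : ℝ) <
      (π / (Lam / 2)) ^ (Module.finrank ℝ (EuclideanSpace ℝ (Fin n)) / 2 : ℝ)) :
    (1 - exp (-(lam * R ^ 2 / 4)) * (π / (lam / 4)) ^ (Module.finrank ℝ (EuclideanSpace ℝ (Fin n)) / 2 : ℝ) /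
        ((π / (Lam / 2)) ^ (Module.finrank ℝ (EuclideanSpace ℝ (Fin n)) / 2 : ℝ) -
          exp (-(Lam * R ^ 2 / 4)) * (π / (Lam / 4)) ^ (Module.finrank ℝ (EuclideanSpace ℝ (Fin n)) / 2 : ℝ))) * ∫ y, exp (-V y) ≤
      ∫ y in {y | ‖y - x₀‖ < R}, exp (-V y) :=
  ballMass_ge_of_localPinch hlam hLam hR x₀ (ConvexWindowMass.lowerPinch_of_firstOrder hV hcrit) hup hZ hΛR

end Summit.QuantumFields.BalabanUV.T4Continuum.NE7b.ConvexWindowMassLocal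

end
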